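import Mathlib
import Literature.MathematicalPhysics.AQFT.OSAxiomsSchwinger
import HarnessLib

/-!
# Soft OS-assembly toolkit IV: flat decay of `⁰𝒮` test functions at the coincidence locus

Helper file for stub `stub_assembly` of crux `OSLegsFromFemtoAndGap` (stmt-QuantumFields-9367, line
`dlr-collar-transfer`).  The lattice `n`-point moments of a dimension-four field are of size `(a/d)⁴ⁿ` at physical
pairwise distance `d` (the collar output `MomentBounds`); what makes the smeared `n`-point distributions bounded
uniformly in the spacing is that the test functions of `⁰𝒮` (Mathlib/tree `IsOffDiagonal`: all derivatives vanish at
coincident points) vanish to every order there.  This file proves the quantitative form: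

* `norm_iteratedFDeriv_le_of_vanish` — Taylor by iterated mean values: if all derivatives of order `< N` of a
  smooth `F` vanish at `z`, then `‖F y‖ ≤ B ‖y − z‖ᴺ` whenever `‖D^N F‖ ≤ B` on the segment `[z, y]`;
* `IsOffDiagonal.norm_le_seminorm_mul_dist_pow` — for `F ∈ ⁰𝒮((Eⁿ))`, every `k, N`, all `i ≠ j` and all `y`:
  `‖y‖ᵏ ‖F y‖ ≤ 𝓢-seminorm_{k,N}(F) · ‖yᵢ − yⱼ‖ᴺ` (the segment to the coincident point `yⱼ := yᵢ` — or `yᵢ := yⱼ`,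
  whichever keeps the largest coordinate fixed — stays outside the ball of radius `‖y‖`, so the Schwartz weight is
  not lost).

References: Osterwalder–Schrader 1975 §2 (`⁰𝒮`); Kravchuk–Qiao–Rychkov 2021 Remark 2.4.
-/

noncomputable section

open scoped SchwartzMap Topology
open Filter Set Literature.MathematicalPhysics.AQFT

namespace Summit.QuantumFields.YangMills.Theorems.OSLegsFromFemtoAndGap

section Taylor

variable {V : Type*} [NormedAddCommGroup V] [NormedSpace ℝ V]

/-- **Taylor bound by iterated mean values.** Let `F : V → ℂ` be smooth with `D^m F(z) = 0` for all `m < N`, and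
`‖D^N F(w)‖ ≤ B` on the segment `[z, y]`. Then for every `j ≤ N` and `w ∈ [z, y]`,
`‖D^{N-j} F(w)‖ ≤ B ‖y − z‖ʲ`; in particular (`j = N`, `w = y`) `‖F y‖ ≤ B ‖y − z‖ᴺ`. [folklore] -/
theorem norm_iteratedFDeriv_le_of_vanish {F : V → ℂ} (hF : ContDiff ℝ (⊤ : ℕ∞) F) {z y : V} {N : ℕ} {B : ℝ}
    (hB0 : 0 ≤ B) (hz : ∀ m < N, iteratedFDeriv ℝ m F z = 0)
    (hB : ∀ w ∈ segment ℝ z y, ‖iteratedFDeriv ℝ N F w‖ ≤ B) :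
    ∀ j ≤ N, ∀ w ∈ segment ℝ z y, ‖iteratedFDeriv ℝ (N - j) F w‖ ≤ B * ‖y - z‖ ^ j := by
  intro j
  induction j with
  | zero => intro _ w hw; simpa using hB w hw
  | succ j ih =>
    intro hj w hw
    have hj' : j ≤ N := Nat.le_of_succ_le hj
    have hNj : N - j = (N - (j + 1)) + 1 := by omega
    -- the function `g = D^{N-j-1} F` vanishes at `z` and has derivative bounded by `B ‖y-z‖^j` on the segment
    set g : V → (V [×(N - (j + 1))]→L[ℝ] ℂ) := fun x => iteratedFDeriv ℝ (N - (j + 1)) F x with hg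
    have hgz : g z = 0 := hz _ (by omega)
    have hdiff : ∀ x ∈ segment ℝ z y, DifferentiableAt ℝ g x := fun x _ =>
      (hF.differentiable_iteratedFDeriv (m := N - (j + 1))
        (WithTop.coe_lt_coe.2 (WithTop.coe_lt_top (N - (j + 1))))) x
    have hbound : ∀ x ∈ segment ℝ z y, ‖fderiv ℝ g x‖ ≤ B * ‖y - z‖ ^ j := by
      intro x hx
      rw [hg, norm_fderiv_iteratedFDeriv, ← hNj]
      exact ih hj' x hx
    have hmvt := (convex_segment z y).norm_image_sub_le_of_norm_fderiv_le hdiff hbound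
      (left_mem_segment ℝ z y) hw
    rw [hgz, sub_zero] at hmvt
    -- `‖w - z‖ ≤ ‖y - z‖` on the segment
    have hwz : ‖w - z‖ ≤ ‖y - z‖ := norm_sub_le_of_mem_segment hw
    calc ‖iteratedFDeriv ℝ (N - (j + 1)) F w‖ = ‖g w‖ := rfl
      _ ≤ B * ‖y - z‖ ^ j * ‖w - z‖ := hmvt
      _ ≤ B * ‖y - z‖ ^ j * ‖y - z‖ := by gcongr
      _ = B * ‖y - z‖ ^ (j + 1) := by ring

end Taylor


section OffDiagonal

variable {E : Type*} [NormedAddCommGroup E] [NormedSpace ℝ E] {n : ℕ}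

/-- On the segment from `Function.update y c v` to `y`, every coordinate other than `c` is frozen at its value in
`y`. [folklore] -/
theorem apply_eq_of_mem_segment_update {y : Fin n → E} {c l : Fin n} (hlc : l ≠ c) (v : E) {w : Fin n → E}
    (hw : w ∈ segment ℝ (Function.update y c v) y) : w l = y l := by
  obtain ⟨a, b, -, -, hab, rfl⟩ := hw
  simp only [Pi.add_apply, Pi.smul_apply, Function.update_of_ne hlc]
  rw [← add_smul, hab, one_smul]

omit [NormedSpace ℝ E] in
/-- `‖y − update y c v‖ = ‖y c − v‖` for the sup norm. [folklore] -/
theorem norm_sub_update (y : Fin n → E) (c : Fin n) (v : E) : ‖y - Function.update y c v‖ = ‖y c - v‖ := by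
  have h : y - Function.update y c v = Pi.single c (y c - v) := by
    funext l
    by_cases hl : l = c
    · subst hl; simp
    · simp [hl]
  rw [h, Pi.norm_single]

/-- **Weighted flat decay of `⁰𝒮` functions at the coincidence locus.** For `F ∈ ⁰𝒮(Eⁿ)` (all derivatives
vanish at coincident points), all `k N : ℕ`, all `i ≠ j` and every `y`:
`‖y‖ᵏ · ‖F y‖ ≤ 𝓢-seminorm_{k,N}(F) · ‖yᵢ − yⱼ‖ᴺ`. [folklore] -/
theorem offDiagonal_pow_mul_norm_le (F : 𝓢((Fin n → E), ℂ)) (hF : IsOffDiagonal F) (k N : ℕ)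
    {i j : Fin n} (hij : i ≠ j) (y : Fin n → E) :
    ‖y‖ ^ k * ‖F y‖ ≤ SchwartzMap.seminorm ℂ k N F * ‖y i - y j‖ ^ N := by
  classical
  -- trivial when `yᵢ = yⱼ`: then `y` is a coincident point and `F y = 0`
  by_cases hyij : y i = y j
  · have hy : y ∈ coincidenceLocus n E := ⟨i, j, hij, hyij⟩
    rw [hF.apply_eq_zero hy, norm_zero, mul_zero]
    positivity
  have hdpos : 0 < ‖y i - y j‖ := norm_pos_iff.2 (sub_ne_zero.2 hyij)
  have hypos : 0 < ‖y‖ := by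
    by_contra h
    have h0 : y = 0 := norm_le_zero_iff.1 (not_lt.1 h)
    exact hyij (by simp [h0])
  -- a coordinate of maximal norm
  obtain ⟨l, -, hl⟩ := Finset.exists_max_image Finset.univ (fun l => ‖y l‖) ⟨i, Finset.mem_univ _⟩
  have hyl : ‖y‖ = ‖y l‖ :=
    le_antisymm ((pi_norm_le_iff_of_nonneg (norm_nonneg _)).2 fun l' => hl l' (Finset.mem_univ _))
      (norm_le_pi_norm y l)
  -- the coincident point `z`: move a coordinate `c ∉ {l}` of the pair `{i, j}` onto the other one
  obtain ⟨c, v, hcl, hz, hdist⟩ : ∃ (c : Fin n) (v : E), l ≠ c ∧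
      Function.update y c v ∈ coincidenceLocus n E ∧ ‖y - Function.update y c v‖ = ‖y i - y j‖ := by
    by_cases hlj : l = j
    · refine ⟨i, y j, fun h => hij (h.symm.trans hlj), ⟨i, j, hij, ?_⟩, ?_⟩
      · simp [Function.update_of_ne (Ne.symm hij)]
      · rw [norm_sub_update]
    · refine ⟨j, y i, hlj, ⟨i, j, hij, ?_⟩, ?_⟩
      · simp [Function.update_of_ne hij]
      · rw [norm_sub_update, norm_sub_rev]
  set z := Function.update y c v with hzdef
  -- on the segment `[z, y]` the `l`-th coordinate is frozen, so `‖w‖ ≥ ‖y‖`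
  have hw : ∀ w ∈ segment ℝ z y, ‖y‖ ≤ ‖w‖ := fun w hw => by
    have hwl : w l = y l := apply_eq_of_mem_segment_update hcl v hw
    rw [hyl, ← hwl]
    exact norm_le_pi_norm w l
  -- bound on `D^N F` along the segment, with the weight moved to `y`
  set S := SchwartzMap.seminorm ℂ k N F with hS
  have hB : ∀ w ∈ segment ℝ z y, ‖iteratedFDeriv ℝ N (F : (Fin n → E) → ℂ) w‖ ≤ S / ‖y‖ ^ k := by
    intro w hwm
    rw [le_div_iff₀ (pow_pos hypos k)]
    calc ‖iteratedFDeriv ℝ N (F : (Fin n → E) → ℂ) w‖ * ‖y‖ ^ k ≤ ‖iteratedFDeriv ℝ N (F : (Fin n → E) → ℂ) w‖ * ‖w‖ ^ k := by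
          gcongr; exact hw w hwm
      _ = ‖w‖ ^ k * ‖iteratedFDeriv ℝ N (F : (Fin n → E) → ℂ) w‖ := mul_comm _ _
      _ ≤ S := SchwartzMap.le_seminorm ℂ k N F w
  have hz0 : ∀ m < N, iteratedFDeriv ℝ m (F : (Fin n → E) → ℂ) z = 0 := fun m _ => hF z hz m
  have key := norm_iteratedFDeriv_le_of_vanish (F.smooth ⊤) (by positivity) hz0 hB N le_rfl y
    (right_mem_segment ℝ z y)
  rw [Nat.sub_self, norm_iteratedFDeriv_zero, hdist] at key
  calc ‖y‖ ^ k * ‖F y‖ ≤ ‖y‖ ^ k * (S / ‖y‖ ^ k * ‖y i - y j‖ ^ N) := by gcongr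
    _ = S * ‖y i - y j‖ ^ N := by field_simp

end OffDiagonal

end Summit.QuantumFields.YangMills.Theorems.OSLegsFromFemtoAndGap

end
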